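import Mathlib
import Summits.HubbardSuperconductivity.HubbardSuperconductivity.Theorems.BalabanIRBirComplexStableXYFixedVolumeGauss
import HarnessLib

/-!
# Crux `BirComplexStableXYR` (stmt-HubbardSuperconductivity-14845): Gaussian integrals with a linear
# phase — the spin-wave characteristic function and its variational lower bound

Support file (prover seat 0, route BalabanIR) for the restated engine
`…Theses.BalabanIR.BirComplexStableXYR`, first of three files proving the GAUSSIAN BACKBONE of the
crux (spin-wave theory of an arbitrary admissible table is volume-uniform, `…RSpinWave`).

Abstract finite-dimensional facts.  For a real positive definite matrix `S` on `ℝ^ι` and `b ∈ ℝ^ι`: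

* `gph_integral_phase_eq` — `∫ exp(i b·v − ½ vᵀSv) dv = exp(−σ/2) ∫ exp(−½ vᵀSv) dv` with
  `σ = Σ_i (Uᵀb)_i² / a_i` for the spectral decomposition `S = U diag(a) Uᵀ` (i.e. `σ = bᵀS⁻¹b`, the
  variance of `b·v`); proof: orthogonal change of variables and the product of one-dimensional Gaussian
  Fourier transforms (Mathlib `integral_cexp_neg_sum_mul_add`);
* `gph_sigma_le` — the variational bound `σ ≤ G` whenever `2 b·v − vᵀSv ≤ G` for all `v`
  (`σ = max_v (2 b·v − vᵀSv)`, attained at `v = S⁻¹b`);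
* `gph_cos_integral_eq`, `gph_cos_integral_ge`, `gph_cos_integral_ge'` — the real form
  `∫ cos(b·v) e^{−½vᵀSv} = e^{−σ/2} ∫ e^{−½vᵀSv} ≥ e^{−G/2} ∫ e^{−½vᵀSv} ≥ (1 − G/2) ∫ e^{−½vᵀSv}`,
  and `gph_gauss_pos` (`0 < ∫ e^{−½vᵀSv}`).

No definitions. [folklore]
-/

noncomputable section

namespace Summit.HubbardSuperconductivity.HubbardSuperconductivity.Theorems

open scoped BigOperators Matrix
open MeasureTheory Complex

section GaussianPhase

variable {ι : Type*} [Fintype ι] [DecidableEq ι]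

/-- `Uᵀ S U = diag(a)` for the spectral decomposition `S = U diag(a) Uᵀ` of a real symmetric matrix.
[folklore] -/
theorem gph_conj_eq_diagonal {S : Matrix ι ι ℝ} (hS : S.IsHermitian) :
    (hS.eigenvectorUnitary : Matrix ι ι ℝ)ᵀ * S * (hS.eigenvectorUnitary : Matrix ι ι ℝ) =
      Matrix.diagonal hS.eigenvalues := by
  set U : Matrix ι ι ℝ := (hS.eigenvectorUnitary : Matrix ι ι ℝ) with hU
  have hUU : Uᵀ * U = 1 := birGauss_transpose_mul_self _
  have hspec : S = U * Matrix.diagonal hS.eigenvalues * Uᵀ := birGauss_spectral hS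
  calc Uᵀ * S * U = Uᵀ * (U * Matrix.diagonal hS.eigenvalues * Uᵀ) * U := by rw [← hspec]
    _ = (Uᵀ * U) * Matrix.diagonal hS.eigenvalues * (Uᵀ * U) := by simp only [Matrix.mul_assoc]
    _ = Matrix.diagonal hS.eigenvalues := by rw [hUU, Matrix.one_mul, Matrix.mul_one]

omit [DecidableEq ι] in
/-- The quadratic form of a diagonal matrix. [folklore] -/
theorem gph_form_diagonal [DecidableEq ι] (a w : ι → ℝ) :
    w ⬝ᵥ (Matrix.diagonal a *ᵥ w) = ∑ i, a i * w i ^ 2 := by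
  simp only [dotProduct, Matrix.mulVec_diagonal]
  refine Finset.sum_congr rfl fun i _ => ?_
  ring

omit [DecidableEq ι] in
/-- `b · (U w) = (Uᵀ b) · w`. [folklore] -/
theorem gph_dot_mulVec (U : Matrix ι ι ℝ) (b w : ι → ℝ) :
    b ⬝ᵥ (U *ᵥ w) = (Uᵀ *ᵥ b) ⬝ᵥ w := by
  rw [Matrix.dotProduct_mulVec, Matrix.mulVec_transpose]

/-- The orthogonal matrix of the spectral decomposition has non-zero determinant. [folklore] -/
theorem gph_det_ne_zero {S : Matrix ι ι ℝ} (hS : S.IsHermitian) :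
    (hS.eigenvectorUnitary : Matrix ι ι ℝ).det ≠ 0 := by
  have h : (hS.eigenvectorUnitary : Matrix ι ι ℝ)ᵀ * 1 * (hS.eigenvectorUnitary : Matrix ι ι ℝ) = 1 := by
    rw [Matrix.mul_one]; exact birGauss_transpose_mul_self _
  exact birGauss_det_ne_zero h

omit [DecidableEq ι] in
/-- **Diagonal Gaussian with a linear phase** (product of one-dimensional Gaussian Fourier
transforms): for `a_i > 0`,
`∫ exp(i β·w − ½ Σ a_i w_i²) dw = exp(−½ Σ β_i²/a_i) · ∫ exp(−½ Σ a_i w_i²) dw`. [folklore] -/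
theorem gph_integral_diag {a : ι → ℝ} (ha : ∀ i, 0 < a i) (β : ι → ℝ) :
    (∫ w : ι → ℝ, cexp (I * ((β ⬝ᵥ w : ℝ) : ℂ) - (1 / 2 : ℂ) * ((∑ i, a i * w i ^ 2 : ℝ) : ℂ)))
      = cexp (-(1 / 2 : ℂ) * ((∑ i, β i ^ 2 / a i : ℝ) : ℂ)) *
          ∫ w : ι → ℝ, cexp (-(1 / 2 : ℂ) * ((∑ i, a i * w i ^ 2 : ℝ) : ℂ)) := by
  -- Mathlib's product formula with `b i = a i / 2`, `c i = I β i` resp. `c i = 0`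
  set bb : ι → ℂ := fun i => ((a i / 2 : ℝ) : ℂ) with hbb
  have hb : ∀ i, 0 < (bb i).re := fun i => by
    simp only [hbb, Complex.ofReal_re]; exact half_pos (ha i)
  have hA : ∀ w : ι → ℝ, (1 / 2 : ℂ) * ((∑ i, a i * w i ^ 2 : ℝ) : ℂ) = ∑ i, bb i * (w i : ℂ) ^ 2 := by
    intro w
    push_cast
    rw [Finset.mul_sum]
    refine Finset.sum_congr rfl fun i _ => ?_
    simp only [hbb]
    push_cast
    ring
  have hB : ∀ w : ι → ℝ, I * ((β ⬝ᵥ w : ℝ) : ℂ) = ∑ i, (I * (β i : ℂ)) * (w i : ℂ) := by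
    intro w
    simp only [dotProduct]
    push_cast
    rw [Finset.mul_sum]
    refine Finset.sum_congr rfl fun i _ => ?_
    ring
  have hphase : ∀ w : ι → ℝ, I * ((β ⬝ᵥ w : ℝ) : ℂ) - (1 / 2 : ℂ) * ((∑ i, a i * w i ^ 2 : ℝ) : ℂ)
      = -∑ i, bb i * (w i : ℂ) ^ 2 + ∑ i, (I * (β i : ℂ)) * (w i : ℂ) := by
    intro w
    rw [hB, hA]
    ring
  have hplain : ∀ w : ι → ℝ, -(1 / 2 : ℂ) * ((∑ i, a i * w i ^ 2 : ℝ) : ℂ)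
      = -∑ i, bb i * (w i : ℂ) ^ 2 + ∑ i, (0 : ℂ) * (w i : ℂ) := by
    intro w
    rw [neg_mul, hA]
    simp
  simp_rw [hphase, hplain, GaussianFourier.integral_cexp_neg_sum_mul_add hb, Finset.prod_mul_distrib]
  have h0 : ∏ i, cexp ((0 : ℂ) ^ 2 / (4 * bb i)) = 1 := by simp
  rw [h0, mul_one, mul_comm]
  congr 1
  rw [← Complex.exp_sum]
  congr 1
  simp only [Complex.ofReal_sum, Complex.ofReal_div, Complex.ofReal_pow, hbb, Finset.mul_sum]
  refine Finset.sum_congr rfl fun i _ => ?_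
  have hai : ((a i : ℝ) : ℂ) ≠ 0 := by exact_mod_cast (ha i).ne'
  field_simp
  rw [Complex.I_sq]
  push_cast
  ring

/-- **Gaussian integral with a linear phase.**  For `S` positive definite with spectral data
`S = U diag(a) Uᵀ`:  `∫ exp(i b·v − ½ vᵀSv) dv = exp(−½ Σ_i (Uᵀb)_i²/a_i) · ∫ exp(−½ vᵀSv) dv`
(the exponent is `−½ bᵀS⁻¹b`). [folklore] -/
theorem gph_integral_phase_eq {S : Matrix ι ι ℝ} (hS : S.PosDef) (b : ι → ℝ) :
    (∫ v : ι → ℝ, cexp (I * ((b ⬝ᵥ v : ℝ) : ℂ) - (1 / 2 : ℂ) * ((v ⬝ᵥ (S *ᵥ v) : ℝ) : ℂ)))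
      = cexp (-(1 / 2 : ℂ) * ((∑ i, ((hS.1.eigenvectorUnitary : Matrix ι ι ℝ)ᵀ *ᵥ b) i ^ 2 /
            hS.1.eigenvalues i : ℝ) : ℂ)) *
          ∫ v : ι → ℝ, cexp (-(1 / 2 : ℂ) * ((v ⬝ᵥ (S *ᵥ v) : ℝ) : ℂ)) := by
  set U : Matrix ι ι ℝ := (hS.1.eigenvectorUnitary : Matrix ι ι ℝ) with hU
  set a : ι → ℝ := hS.1.eigenvalues with ha
  have hapos : ∀ i, 0 < a i := fun i => hS.eigenvalues_pos i
  have hdet : U.det ≠ 0 := gph_det_ne_zero hS.1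
  have hdiag : Uᵀ * S * U = Matrix.diagonal a := gph_conj_eq_diagonal hS.1
  have hformU : ∀ w : ι → ℝ, (U *ᵥ w) ⬝ᵥ (S *ᵥ (U *ᵥ w)) = ∑ i, a i * w i ^ 2 := by
    intro w
    rw [birGauss_form_congr S U w, hdiag, gph_form_diagonal]
  have hdotU : ∀ w : ι → ℝ, b ⬝ᵥ (U *ᵥ w) = (Uᵀ *ᵥ b) ⬝ᵥ w := fun w => gph_dot_mulVec U b w
  have hc1 : Continuous fun v : ι → ℝ =>
      cexp (I * ((b ⬝ᵥ v : ℝ) : ℂ) - (1 / 2 : ℂ) * ((v ⬝ᵥ (S *ᵥ v) : ℝ) : ℂ)) := by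
    refine Complex.continuous_exp.comp ?_
    refine Continuous.sub ?_ ?_
    · refine continuous_const.mul (Complex.continuous_ofReal.comp ?_)
      exact continuous_const.dotProduct continuous_id
    · refine continuous_const.mul (Complex.continuous_ofReal.comp ?_)
      exact continuous_id.dotProduct (continuous_const.matrix_mulVec continuous_id)
  have hc2 : Continuous fun v : ι → ℝ => cexp (-(1 / 2 : ℂ) * ((v ⬝ᵥ (S *ᵥ v) : ℝ) : ℂ)) := by
    refine Complex.continuous_exp.comp ?_
    refine continuous_const.mul (Complex.continuous_ofReal.comp ?_)
    exact continuous_id.dotProduct (continuous_const.matrix_mulVec continuous_id)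
  rw [birGauss_integral_comp_mulVec hdet hc1, birGauss_integral_comp_mulVec hdet hc2]
  simp only [hformU, hdotU]
  rw [gph_integral_diag hapos (Uᵀ *ᵥ b)]
  ring

/-- **Variational bound on the variance**: if `2 b·v − vᵀSv ≤ G` for every `v`, then
`Σ_i (Uᵀb)_i²/a_i ≤ G` (the maximum is attained at `v = U (Uᵀb / a) = S⁻¹ b`). [folklore] -/
theorem gph_sigma_le {S : Matrix ι ι ℝ} (hS : S.PosDef) (b : ι → ℝ) {G : ℝ}
    (hG : ∀ v : ι → ℝ, 2 * (b ⬝ᵥ v) - v ⬝ᵥ (S *ᵥ v) ≤ G) :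
    (∑ i, ((hS.1.eigenvectorUnitary : Matrix ι ι ℝ)ᵀ *ᵥ b) i ^ 2 / hS.1.eigenvalues i) ≤ G := by
  set U : Matrix ι ι ℝ := (hS.1.eigenvectorUnitary : Matrix ι ι ℝ) with hU
  set a : ι → ℝ := hS.1.eigenvalues with ha
  set β : ι → ℝ := Uᵀ *ᵥ b with hβ
  have hapos : ∀ i, 0 < a i := fun i => hS.eigenvalues_pos i
  have hdiag : Uᵀ * S * U = Matrix.diagonal a := gph_conj_eq_diagonal hS.1
  set w : ι → ℝ := fun i => β i / a i with hw
  have h1 : b ⬝ᵥ (U *ᵥ w) = ∑ i, β i ^ 2 / a i := by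
    rw [gph_dot_mulVec U b w]
    simp only [dotProduct, hw, ← hβ]
    refine Finset.sum_congr rfl fun i _ => ?_
    rw [div_eq_mul_inv]
    ring
  have h2 : (U *ᵥ w) ⬝ᵥ (S *ᵥ (U *ᵥ w)) = ∑ i, β i ^ 2 / a i := by
    rw [birGauss_form_congr S U w, hdiag, gph_form_diagonal]
    refine Finset.sum_congr rfl fun i _ => ?_
    simp only [hw]
    have := (hapos i).ne'
    field_simp
  have := hG (U *ᵥ w)
  rw [h1, h2] at this
  linarith

omit [DecidableEq ι] in
/-- The complex Gaussian integral of a real form is the real one. [folklore] -/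
theorem gph_integral_ofReal {S : Matrix ι ι ℝ} :
    (∫ v : ι → ℝ, cexp (-(1 / 2 : ℂ) * ((v ⬝ᵥ (S *ᵥ v) : ℝ) : ℂ)))
      = ((∫ v : ι → ℝ, Real.exp (-(1 / 2) * (v ⬝ᵥ (S *ᵥ v))) : ℝ) : ℂ) := by
  rw [← integral_complex_ofReal]
  refine integral_congr_ae (Filter.Eventually.of_forall fun v => ?_)
  show cexp _ = ((Real.exp _ : ℝ) : ℂ)
  rw [Complex.ofReal_exp]
  congr 1
  push_cast
  ring

/-- The complex Gaussian integral of a positive definite real form is non-zero. [folklore] -/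
theorem gph_integral_ne_zero {S : Matrix ι ι ℝ} (hS : S.PosDef) :
    (∫ v : ι → ℝ, cexp (-(1 / 2 : ℂ) * ((v ⬝ᵥ (S *ᵥ v) : ℝ) : ℂ))) ≠ 0 := by
  set U : Matrix ι ι ℝ := (hS.1.eigenvectorUnitary : Matrix ι ι ℝ) with hU
  set a : ι → ℝ := hS.1.eigenvalues with ha
  have hapos : ∀ i, 0 < a i := fun i => hS.eigenvalues_pos i
  have hdet : U.det ≠ 0 := gph_det_ne_zero hS.1
  have hdiag : Uᵀ * S * U = Matrix.diagonal a := gph_conj_eq_diagonal hS.1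
  have hc2 : Continuous fun v : ι → ℝ => cexp (-(1 / 2 : ℂ) * ((v ⬝ᵥ (S *ᵥ v) : ℝ) : ℂ)) := by
    refine Complex.continuous_exp.comp ?_
    refine continuous_const.mul (Complex.continuous_ofReal.comp ?_)
    exact continuous_id.dotProduct (continuous_const.matrix_mulVec continuous_id)
  rw [birGauss_integral_comp_mulVec hdet hc2]
  refine mul_ne_zero (by exact_mod_cast (abs_pos.2 hdet).ne') ?_
  have hformU : ∀ w : ι → ℝ, (U *ᵥ w) ⬝ᵥ (S *ᵥ (U *ᵥ w)) = ∑ i, a i * w i ^ 2 := by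
    intro w
    rw [birGauss_form_congr S U w, hdiag, gph_form_diagonal]
  simp only [hformU]
  set bb : ι → ℂ := fun i => ((a i / 2 : ℝ) : ℂ) with hbb
  have hb : ∀ i, 0 < (bb i).re := fun i => by
    simp only [hbb, Complex.ofReal_re]; exact half_pos (hapos i)
  have hA : ∀ w : ι → ℝ, (1 / 2 : ℂ) * ((∑ i, a i * w i ^ 2 : ℝ) : ℂ) = ∑ i, bb i * (w i : ℂ) ^ 2 := by
    intro w
    push_cast
    rw [Finset.mul_sum]
    refine Finset.sum_congr rfl fun i _ => ?_
    simp only [hbb]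
    push_cast
    ring
  have hplain : ∀ w : ι → ℝ, -(1 / 2 : ℂ) * ((∑ i, a i * w i ^ 2 : ℝ) : ℂ)
      = -∑ i, bb i * (w i : ℂ) ^ 2 + ∑ i, (0 : ℂ) * (w i : ℂ) := by
    intro w
    rw [neg_mul, hA]
    simp
  simp_rw [hplain, GaussianFourier.integral_cexp_neg_sum_mul_add hb]
  refine Finset.prod_ne_zero_iff.2 fun i _ => mul_ne_zero ?_ (Complex.exp_ne_zero _)
  rw [Ne, Complex.cpow_eq_zero_iff, not_and_or]
  left
  refine div_ne_zero (by exact_mod_cast Real.pi_ne_zero) ?_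
  intro h0
  have := congrArg Complex.re h0
  simp only [hbb, Complex.ofReal_re, Complex.zero_re] at this
  linarith [hapos i]

/-- The real Gaussian `exp(−½ vᵀSv)` of a positive definite form is integrable. [folklore] -/
theorem gph_gauss_integrable {S : Matrix ι ι ℝ} (hS : S.PosDef) :
    Integrable (fun v : ι → ℝ => Real.exp (-(1 / 2) * (v ⬝ᵥ (S *ᵥ v)))) := by
  have hC : Integrable (fun v : ι → ℝ => cexp (-(1 / 2 : ℂ) * ((v ⬝ᵥ (S *ᵥ v) : ℝ) : ℂ))) := by
    by_contra h
    exact gph_integral_ne_zero hS (integral_undef h)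
  have := hC.re
  refine this.congr (Filter.Eventually.of_forall fun v => ?_)
  show (cexp (-(1 / 2 : ℂ) * ((v ⬝ᵥ (S *ᵥ v) : ℝ) : ℂ))).re = Real.exp (-(1 / 2) * (v ⬝ᵥ (S *ᵥ v)))
  have : -(1 / 2 : ℂ) * ((v ⬝ᵥ (S *ᵥ v) : ℝ) : ℂ) = ((-(1 / 2) * (v ⬝ᵥ (S *ᵥ v)) : ℝ) : ℂ) := by
    push_cast; ring
  rw [this, Complex.exp_ofReal_re]

/-- The Gaussian with a linear phase `exp(i b·v − ½ vᵀSv)` is integrable. [folklore] -/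
theorem gph_phase_integrable {S : Matrix ι ι ℝ} (hS : S.PosDef) (b : ι → ℝ) :
    Integrable (fun v : ι → ℝ =>
      cexp (I * ((b ⬝ᵥ v : ℝ) : ℂ) - (1 / 2 : ℂ) * ((v ⬝ᵥ (S *ᵥ v) : ℝ) : ℂ))) := by
  refine (gph_gauss_integrable hS).mono' ?_ (Filter.Eventually.of_forall fun v => ?_)
  · refine (Complex.continuous_exp.comp ?_).aestronglyMeasurable
    refine Continuous.sub ?_ ?_
    · refine continuous_const.mul (Complex.continuous_ofReal.comp ?_)
      exact continuous_const.dotProduct continuous_id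
    · refine continuous_const.mul (Complex.continuous_ofReal.comp ?_)
      exact continuous_id.dotProduct (continuous_const.matrix_mulVec continuous_id)
  · rw [Complex.norm_exp]
    apply le_of_eq
    simp

/-- **Positivity of the Gaussian normalisation** `0 < ∫ exp(−½ vᵀSv) dv`. [folklore] -/
theorem gph_gauss_pos {S : Matrix ι ι ℝ} (hS : S.PosDef) :
    0 < ∫ v : ι → ℝ, Real.exp (-(1 / 2) * (v ⬝ᵥ (S *ᵥ v))) :=
  integral_exp_pos (gph_gauss_integrable hS)

/-- **The spin-wave characteristic function, real form**:
`∫ cos(b·v) e^{−½vᵀSv} dv = exp(−½ Σ_i (Uᵀb)_i²/a_i) · ∫ e^{−½vᵀSv} dv`. [folklore] -/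
theorem gph_cos_integral_eq {S : Matrix ι ι ℝ} (hS : S.PosDef) (b : ι → ℝ) :
    (∫ v : ι → ℝ, Real.cos (b ⬝ᵥ v) * Real.exp (-(1 / 2) * (v ⬝ᵥ (S *ᵥ v))))
      = Real.exp (-(1 / 2) * ∑ i, ((hS.1.eigenvectorUnitary : Matrix ι ι ℝ)ᵀ *ᵥ b) i ^ 2 /
            hS.1.eigenvalues i) *
          ∫ v : ι → ℝ, Real.exp (-(1 / 2) * (v ⬝ᵥ (S *ᵥ v))) := by
  have hpt : ∀ v : ι → ℝ, Real.cos (b ⬝ᵥ v) * Real.exp (-(1 / 2) * (v ⬝ᵥ (S *ᵥ v)))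
      = (cexp (I * ((b ⬝ᵥ v : ℝ) : ℂ) - (1 / 2 : ℂ) * ((v ⬝ᵥ (S *ᵥ v) : ℝ) : ℂ))).re := by
    intro v
    have hre : (I * ((b ⬝ᵥ v : ℝ) : ℂ) - (1 / 2 : ℂ) * ((v ⬝ᵥ (S *ᵥ v) : ℝ) : ℂ)).re
        = -(1 / 2) * (v ⬝ᵥ (S *ᵥ v)) := by
      simp
    have him : (I * ((b ⬝ᵥ v : ℝ) : ℂ) - (1 / 2 : ℂ) * ((v ⬝ᵥ (S *ᵥ v) : ℝ) : ℂ)).im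
        = b ⬝ᵥ v := by
      simp
    rw [Complex.exp_re, hre, him, mul_comm]
  simp_rw [hpt]
  have hI := integral_re (gph_phase_integrable hS b)
  simp only [RCLike.re_to_complex] at hI
  rw [hI, gph_integral_phase_eq hS b, gph_integral_ofReal]
  set σ : ℝ := ∑ i, ((hS.1.eigenvectorUnitary : Matrix ι ι ℝ)ᵀ *ᵥ b) i ^ 2 / hS.1.eigenvalues i
  have : -(1 / 2 : ℂ) * ((σ : ℝ) : ℂ) = ((-(1 / 2) * σ : ℝ) : ℂ) := by push_cast; ring
  rw [this, ← Complex.ofReal_exp, ← Complex.ofReal_mul, Complex.ofReal_re]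

/-- **Lower bound on the cosine average under a Gaussian**: if `2 b·v − vᵀSv ≤ G` for all `v`, then
`e^{−G/2} ∫ e^{−½vᵀSv} ≤ ∫ cos(b·v) e^{−½vᵀSv}`. [folklore] -/
theorem gph_cos_integral_ge {S : Matrix ι ι ℝ} (hS : S.PosDef) (b : ι → ℝ) {G : ℝ}
    (hG : ∀ v : ι → ℝ, 2 * (b ⬝ᵥ v) - v ⬝ᵥ (S *ᵥ v) ≤ G) :
    Real.exp (-(G / 2)) * ∫ v : ι → ℝ, Real.exp (-(1 / 2) * (v ⬝ᵥ (S *ᵥ v)))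
      ≤ ∫ v : ι → ℝ, Real.cos (b ⬝ᵥ v) * Real.exp (-(1 / 2) * (v ⬝ᵥ (S *ᵥ v))) := by
  rw [gph_cos_integral_eq hS b]
  refine mul_le_mul_of_nonneg_right ?_ (gph_gauss_pos hS).le
  refine Real.exp_le_exp.2 ?_
  have := gph_sigma_le hS b hG
  linarith

/-- **Linearised form** `(1 − G/2) ∫ e^{−½vᵀSv} ≤ ∫ cos(b·v) e^{−½vᵀSv}` (from `1 + x ≤ eˣ`).
[folklore] -/
theorem gph_cos_integral_ge' {S : Matrix ι ι ℝ} (hS : S.PosDef) (b : ι → ℝ) {G : ℝ}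
    (hG : ∀ v : ι → ℝ, 2 * (b ⬝ᵥ v) - v ⬝ᵥ (S *ᵥ v) ≤ G) :
    (1 - G / 2) * ∫ v : ι → ℝ, Real.exp (-(1 / 2) * (v ⬝ᵥ (S *ᵥ v)))
      ≤ ∫ v : ι → ℝ, Real.cos (b ⬝ᵥ v) * Real.exp (-(1 / 2) * (v ⬝ᵥ (S *ᵥ v))) := by
  refine le_trans ?_ (gph_cos_integral_ge hS b hG)
  refine mul_le_mul_of_nonneg_right ?_ (gph_gauss_pos hS).le
  have := Real.add_one_le_exp (-(G / 2))
  linarith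

end GaussianPhase

end Summit.HubbardSuperconductivity.HubbardSuperconductivity.Theorems
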